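import Literature.Computability.Complexity.SetLowerBoundProtocol
import HarnessLib

/-!
# The Goldwasser–Sipser basic test with a FINE gap (Aaronson–Hung 2023, Lemma 5.2), counting form

Continuation of `SetLowerBoundProtocol.lean` (the basic test `Hit S (h, y)` over the affine family
`AffineHash.Hash m k`, its hit density `hitDensity k S = Pr_{h,y}[∃ x ∈ S, h x = y]` and the
two-sided bound `μ − μ²/2 ≤ Pr[Hit] ≤ μ`, `μ = |S|/2^k`). That file separates `|S| ≥ K` from
`|S| ≤ K/2` (gap a constant times `K/2^k`). Approximate-counting reductions with a small promise
gap need the FINE version: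

> **Lemma 5.2** (Aaronson–Hung 2023). For real `α > 1` and integer `κ`, there exists an
> Arthur–Merlin protocol which on input the description of a set `S`, determines `ακ ≥ |S| ≥ κ` or
> `|S| ≤ (1−ε)κ` with gap at least `ε²/(4α)` using a hash function of range size `R = 2ακ/ε`.
> [Proof: union bound `Pr ≤ |S|/R`; inclusion–exclusion `Pr ≥ (|S|/R)(1 − |S|/R) ≥ (κ/R)(1 − ε/2)`
> in the yes case, `≤ (κ/R)(1 − ε)` in the no case.]

This file proves the same separation over the tree's objects, with a power-of-two range `2^k`
subject to `2K ≤ ε·2^k` (AH23's `R ≥ 2κ/ε`; the factor `α` and the upper window `|S| ≤ ακ` are NOT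
needed here, because the completeness bound is evaluated on a subset of size exactly `K`, as in
`hitDensity_ge_of_le_card`):

* `hitDensity_le_of_card_le_fine` — no case: `|S| ≤ (1−ε)K ⇒ Pr[Hit] ≤ (1−ε)·K/2^k`;
* `hitDensity_ge_of_le_card_fine` — yes case: `|S| ≥ K`, `2K ≤ ε 2^k ⇒ Pr[Hit] ≥ (1 − ε/4)·K/2^k`;
* `hitDensity_gap_fine` — the gap is `≥ (3/4)·ε·K/2^k`;
* `exists_range_fine`, `gap_fine_gt_sq` — a power of two with `2K ≤ ε 2^k < 4K` exists (`K ≥ 1`,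
  `0 < ε ≤ 1`), and for it the gap exceeds `3ε²/16` (AH23: `ε²/(4α)`).

Exact counting, Mathlib + the parent file only, all proved. Used by the certified-randomness census
of cell qa-cr (the QCAM round of Liu et al. 2025, SM p. 21, applies Lemma 5.2 with `ε/32` in place
of `ε`); independent of everything else.

## References

* [AaronsonHung2023] S. Aaronson, S.-H. Hung, *Certified randomness from quantum supremacy*, STOC
  2023, arXiv:2303.01625, §5.2, Lemma 5.2 (TeX e-print p. 23 L56 – p. 24 L12).
* [AroraBarakCC2009] S. Arora, B. Barak, *Computational Complexity: A Modern Approach*, CUP 2009,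
  §8.2.2.
* S. Goldwasser, M. Sipser, *Private coins versus public coins in interactive proof systems*, STOC
  1986, §4.1.
-/

namespace Literature.Computability.Complexity

open Finset

namespace AffineHash

variable {m k : ℕ}

/-- **No case, fine form**: if `|S| ≤ (1−ε)K` then `Pr[Hit] ≤ (1−ε)·K/2^k` (union bound).
[cite: AaronsonHung2023, Lemma 5.2] -/
theorem hitDensity_le_of_card_le_fine {S : Finset (Fin m → ZMod 2)} {K ε : ℝ}
    (hS : (S.card : ℝ) ≤ (1 - ε) * K) : hitDensity k S ≤ (1 - ε) * K / 2 ^ k := by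
  refine (hitDensity_le S).trans ?_
  exact div_le_div_of_nonneg_right hS (by positivity)

/-- **Yes case, fine form**: if `|S| ≥ K` and `2K ≤ ε·2^k` then `Pr[Hit] ≥ (1 − ε/4)·K/2^k`
(pass to a subset of size exactly `K`; its density is `≥ μ − μ²/2 = μ(1 − μ/2)` with
`μ = K/2^k ≤ ε/2`). [cite: AaronsonHung2023, Lemma 5.2] -/
theorem hitDensity_ge_of_le_card_fine {S : Finset (Fin m → ZMod 2)} {K : ℕ} {ε : ℝ}
    (hKS : K ≤ S.card) (hk : 2 * (K : ℝ) ≤ ε * 2 ^ k) :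
    (1 - ε / 4) * ((K : ℝ) / 2 ^ k) ≤ hitDensity k S := by
  obtain ⟨S', hS'S, hS'card⟩ := Finset.exists_subset_card_eq hKS
  refine le_trans ?_ (hitDensity_mono hS'S)
  refine le_trans ?_ (le_hitDensity S')
  rw [hS'card]
  have h2 : (0 : ℝ) < 2 ^ k := by positivity
  have hμ : (K : ℝ) / 2 ^ k ≤ ε / 2 := by
    rw [div_le_div_iff₀ h2 (by norm_num)]
    linarith
  have hμ0 : (0 : ℝ) ≤ K / 2 ^ k := by positivity
  nlinarith [mul_le_mul_of_nonneg_left hμ hμ0]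

/-- **The fine gap**: yes-sets (`|S| ≥ K`) beat no-sets (`|S'| ≤ (1−ε)K`) in hit density by at
least `(3/4)·ε·K/2^k`, for any range with `2K ≤ ε·2^k`. [cite: AaronsonHung2023, Lemma 5.2] -/
theorem hitDensity_gap_fine {S S' : Finset (Fin m → ZMod 2)} {K : ℕ} {ε : ℝ}
    (hKS : K ≤ S.card) (hS' : (S'.card : ℝ) ≤ (1 - ε) * K) (hk : 2 * (K : ℝ) ≤ ε * 2 ^ k) :
    hitDensity k S' + 3 / 4 * ε * ((K : ℝ) / 2 ^ k) ≤ hitDensity k S := by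
  have h1 := hitDensity_ge_of_le_card_fine (k := k) hKS hk
  have h0 := hitDensity_le_of_card_le_fine (k := k) hS'
  have : (1 - ε) * (K : ℝ) / 2 ^ k + 3 / 4 * ε * ((K : ℝ) / 2 ^ k) =
      (1 - ε / 4) * ((K : ℝ) / 2 ^ k) := by
    ring
  linarith

/-- **A suitable power-of-two range exists**: for `K ≥ 1` and `0 < ε ≤ 1` there is `k` with
`2K ≤ ε·2^k < 4K` (the least `k` with `2K ≤ ε 2^k`; it is positive since `ε·2^0 ≤ 1 < 2K`) —
the protocol's choice of range «set `R = 2ακ/ε`», rounded to a power of two.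
[cite: AaronsonHung2023, Lemma 5.2] -/
theorem exists_range_fine {K : ℕ} {ε : ℝ} (hK : 1 ≤ K) (hε : 0 < ε) (hε1 : ε ≤ 1) :
    ∃ k : ℕ, 2 * (K : ℝ) ≤ ε * 2 ^ k ∧ ε * 2 ^ k < 4 * K := by
  have hex : ∃ k : ℕ, 2 * (K : ℝ) ≤ ε * 2 ^ k := by
    obtain ⟨k, hk⟩ := pow_unbounded_of_one_lt (2 * (K : ℝ) / ε) (by norm_num : (1 : ℝ) < 2)
    exact ⟨k, by rw [div_lt_iff₀ hε] at hk; linarith⟩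
  classical
  refine ⟨Nat.find hex, Nat.find_spec hex, ?_⟩
  have hK1 : (1 : ℝ) ≤ K := by exact_mod_cast hK
  have hpos : 0 < Nat.find hex := by
    rw [Nat.pos_iff_ne_zero]
    intro h0
    have h := Nat.find_spec hex
    rw [h0, pow_zero, mul_one] at h
    linarith
  obtain ⟨j, hj⟩ := Nat.exists_eq_succ_of_ne_zero hpos.ne'
  have hmin : ¬ (2 * (K : ℝ) ≤ ε * 2 ^ j) :=
    Nat.find_min hex (by rw [hj]; exact Nat.lt_succ_self j)
  rw [not_le] at hmin
  rw [hj, pow_succ]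
  linarith

/-- **The fine gap is quadratic in `ε`**: with a range as in `exists_range_fine` (`ε·2^k < 4K`)
the gap `(3/4)·ε·K/2^k` exceeds `3ε²/16` (Aaronson–Hung's `ε²/(4α)`, without the `α`).
[cite: AaronsonHung2023, Lemma 5.2] -/
theorem gap_fine_gt_sq {K k : ℕ} {ε : ℝ} (hε : 0 < ε) (hk : ε * 2 ^ k < 4 * (K : ℝ)) :
    3 * ε ^ 2 / 16 < 3 / 4 * ε * ((K : ℝ) / 2 ^ k) := by
  have h2 : (0 : ℝ) < 2 ^ k := by positivity
  have hq : ε / 4 < (K : ℝ) / 2 ^ k := by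
    rw [div_lt_div_iff₀ (by norm_num) h2]; linarith
  nlinarith [hq, hε]

end AffineHash

end Literature.Computability.Complexity
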